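import Summits.CriticalPhenomena.CardyFormulaZ2.Theorems.CardyIKTransportCornerLineDescentFreezeBlocks2
import Literature.Probability.Percolation.SitePercolationMeasure
import Literature.Probability.Percolation.CornerPercolation
import Literature.Probability.LatticeModels.IsoradialPercolationProofs

/-!
# The frozen end `p = 0` of the corner line: the renewal-grid coupling in law

Support file for the registered stub `stub_FreezeHomogenisation` of the line `symmetric-seed-second-order` of the
crux `CardyIKTransport.CornerLineDescent` (stmt-CriticalPhenomena-10964).  Given the renewal grid (flip enumerations
`eA`, `eB` of the column and row bits) and the black class `c`:
* COORDINATES: the black blocks `(i, j)`, `i + j ≡ c (mod 2)`, ARE the standard lattice `ℤ²` — `latBlk c (m, n) =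
  (m - n, m + n + c)`, inverse `blkLat` (exact on the class); the main diagonal `(i,j) — (i+1,j+1)` is the lattice
  edge `x — x + e₀`, the anti-diagonal `(i,j+1) — (i+1,j)` the edge `x — x + e₁`;
* THE COUPLING MAP `couplingMap eA eB c : coins ↦ BondConfig ℤ²`: `x — x+e₀` open iff the coin of the corner cell of
  `latBlk x` is OFF, `x — x+e₁` open iff the coin of the corner cell of `latBlk x - (1,0)` is ON (one fair coin per
  grid vertex governs exactly one black-class bond); as a set it is the image under the injective `edgeOf` of the
  coins pulled back along the injective governing-corner map and flipped on the type-`0` indices;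
* ITS LAW (anchor `coinLaw_map_couplingMap`): the fair coins push forward to Bernoulli BOND PERCOLATION ON `ℤ²` AT
  `1/2` (`setBernoulli_univ_map_preimage`, the `p = ½` flip invariance, `setBernoulli_univ_map_image`,
  `range edgeOf = (zdGraph 2).edgeSet`);
* WALKS CORRESPOND along `latBlk` / `blkLat` (`blockConnIn_of_latticeConnIn`, `latticeConnIn_of_blockConnIn`).
References: Grimmett, *Percolation* (1999) §1.3; route file `Theses/CardyIKTransport.lean` (items 10964, 4967). -/

noncomputable section

namespace Summit.CriticalPhenomena.CardyFormulaZ2.Theorems.CornerLineDescent.SymmetricSeed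

open scoped BigOperators Topology Classical MeasureTheory ProbabilityTheory ENNReal NNReal
open scoped symmDiff
open Filter Set Function MeasureTheory ProbabilityTheory
open Literature.Probability.Percolation (sitePercolation bondPercolation half BondConfig embDomainCrossing rectangle
  openGraph openGraph_adj openConnIn openCrossing sitePi bernoulliProp)
open Literature.Probability.LatticeModels
open Literature.Probability.RandomPlanarGeometry

namespace Freeze

/-! ## Coordinates: black blocks `(i, j)`, `i + j ≡ c`, are the standard lattice `ℤ²` -/

/-- LATTICE → BLOCK: the black block of the lattice vertex `x = (m, n)` is `(m - n, m + n + c)`. [folklore] -/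
def latBlk (c : ℤ) (x : Site 2) : ℤ × ℤ := (x 0 - x 1, x 0 + x 1 + c)

/-- BLOCK → LATTICE (exact on the parity class `i + j ≡ c`): `(i, j) ↦ ((i + j - c)/2, (j - i - c)/2)`. [folklore] -/
def blkLat (c : ℤ) (b : ℤ × ℤ) : Site 2 := ![(b.1 + b.2 - c) / 2, (b.2 - b.1 - c) / 2]

/-- First block coordinate. [folklore] -/
@[simp] theorem latBlk_fst (c : ℤ) (x : Site 2) : (latBlk c x).1 = x 0 - x 1 := rfl
/-- Second block coordinate. [folklore] -/
@[simp] theorem latBlk_snd (c : ℤ) (x : Site 2) : (latBlk c x).2 = x 0 + x 1 + c := rfl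
/-- First lattice coordinate. [folklore] -/
@[simp] theorem blkLat_apply_zero (c : ℤ) (b : ℤ × ℤ) : blkLat c b 0 = (b.1 + b.2 - c) / 2 := rfl
/-- Second lattice coordinate. [folklore] -/
@[simp] theorem blkLat_apply_one (c : ℤ) (b : ℤ × ℤ) : blkLat c b 1 = (b.2 - b.1 - c) / 2 := rfl

/-- `blkLat ∘ latBlk = id`. [folklore] -/
@[simp] theorem blkLat_latBlk (c : ℤ) (x : Site 2) : blkLat c (latBlk c x) = x := by ext k; fin_cases k <;> (simp; omega)

/-- `latBlk ∘ blkLat = id` on the parity class of `c`. [folklore] -/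
theorem latBlk_blkLat {c : ℤ} {b : ℤ × ℤ} (h : Even (b.1 + b.2 - c)) : latBlk c (blkLat c b) = b := by
  obtain ⟨k, hk⟩ := h
  ext <;> simp <;> omega

/-- Lattice vertices land in the parity class of `c`. [folklore] -/
theorem even_latBlk (c : ℤ) (x : Site 2) : Even ((latBlk c x).1 + (latBlk c x).2 - c) := ⟨x 0, by simp; ring⟩

/-- The unit vectors of `ℤ²`. [folklore] -/
theorem single_zero_eq : (Pi.single 0 1 : Site 2) = ![1, 0] := by ext k; fin_cases k <;> simp

/-- The unit vectors of `ℤ²`. [folklore] -/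
theorem single_one_eq : (Pi.single 1 1 : Site 2) = ![0, 1] := by ext k; fin_cases k <;> simp

/-- Main diagonal: `blkLat (i+1, j+1) = blkLat (i, j) + e₀` on the class. [folklore] -/
theorem blkLat_add_one_one {c : ℤ} {i j : ℤ} (h : Even (i + j - c)) :
    blkLat c (i + 1, j + 1) = blkLat c (i, j) + ![1, 0] := by
  obtain ⟨k, hk⟩ := h
  ext m; fin_cases m <;> simp
  omega

/-- Anti-diagonal: `blkLat (i, j+1) = blkLat (i+1, j) + e₁` on the class of `(i+1, j)`. [folklore] -/
theorem blkLat_anti {c : ℤ} {i j : ℤ} (h : Even (i + 1 + j - c)) :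
    blkLat c (i, j + 1) = blkLat c (i + 1, j) + ![0, 1] := by
  obtain ⟨k, hk⟩ := h
  ext m; fin_cases m <;> simp <;> omega

/-! ## The coupling map: coins ↦ a bond configuration of the standard lattice -/

/-- The lattice edge with index `(x, t)`: `x — x + e_t`. [folklore] -/
def edgeOf (j : Site 2 × Fin 2) : Sym2 (Site 2) := s(j.1, j.1 + Pi.single j.2 1)

variable {A B : Set ℤ}

/-- THE GRID VERTEX GOVERNING A LATTICE EDGE: for `x — x+e₀` (the main diagonal between the blocks `latBlk x` and
`latBlk x + (1,1)`) the corner cell of `latBlk x`; for `x — x+e₁` (the anti-diagonal between `latBlk x = (i, j)` and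
`(i-1, j+1)`) the corner cell of `(i-1, j)`. [folklore] -/
def edgeCorner (eA : FlipEnum A) (eB : FlipEnum B) (c : ℤ) (j : Site 2 × Fin 2) : Site 2 :=
  if j.2 = 0 then cornerCell eA eB (latBlk c j.1).1 (latBlk c j.1).2
  else cornerCell eA eB ((latBlk c j.1).1 - 1) (latBlk c j.1).2

/-- THE COUPLING MAP (coins ↦ standard-lattice bonds, given the grid): the edge `x — x+e₀` is open iff the coin of
its governing corner cell is OFF, the edge `x — x+e₁` iff it is ON; as a set, the image under `edgeOf` of the
pulled-back coins flipped on the type-`0` indices. [folklore] -/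
def couplingMap (eA : FlipEnum A) (eB : FlipEnum B) (c : ℤ) (C : Set (Site 2)) : BondConfig (Site 2) :=
  edgeOf '' ((edgeCorner eA eB c ⁻¹' C) ∆ {j | j.2 = 0})

/-- `edgeOf` is injective. [folklore] -/
theorem edgeOf_injective : Function.Injective edgeOf := by
  rintro ⟨x, t⟩ ⟨y, s⟩ h
  simp only [edgeOf] at h
  rcases Sym2.eq_iff.1 h with ⟨h1, h2⟩ | ⟨h1, h2⟩
  · subst h1
    have h3 : (Pi.single t (1:ℤ) : Site 2) = Pi.single s 1 := add_left_cancel h2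
    have h4 : t = s := by
      by_contra hts
      have := congrFun h3 t
      simp [hts] at this
    subst h4; rfl
  · exfalso
    have h3 : y + Pi.single s 1 + Pi.single t 1 = y := by rw [← h1]; exact h2
    have h4 := congrFun h3 s
    fin_cases s <;> fin_cases t <;> simp at h4 <;> omega

/-- The range of `edgeOf` is the edge set of `ℤ²`. [folklore] -/
theorem range_edgeOf : Set.range edgeOf = (zdGraph 2).edgeSet := by
  ext e
  induction e using Sym2.ind with
  | _ x y =>
    rw [SimpleGraph.mem_edgeSet, zdGraph_adj_iff, Set.mem_range]
    constructor
    · rintro ⟨⟨x', t⟩, h⟩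
      simp only [edgeOf] at h
      rcases Sym2.eq_iff.1 h with ⟨rfl, rfl⟩ | ⟨rfl, rfl⟩
      · exact ⟨t, Or.inl rfl⟩
      · exact ⟨t, Or.inr rfl⟩
    · rintro ⟨t, h | h⟩
      · exact ⟨(x, t), by rw [h]; rfl⟩
      · exact ⟨(y, t), by rw [h]; exact Sym2.eq_swap⟩

/-- Corner cells are injective in the block. [folklore] -/
theorem cornerCell_injective (eA : FlipEnum A) (eB : FlipEnum B) {i j i' j' : ℤ}
    (h : cornerCell eA eB i j = cornerCell eA eB i' j') : i = i' ∧ j = j' := by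
  have h0 := congrFun h 0
  have h1 := congrFun h 1
  simp only [cornerCell, Matrix.cons_val_zero, Matrix.cons_val_one, Matrix.cons_val_fin_one, sub_left_inj] at h0 h1
  exact ⟨by simpa using eA.strictMono.injective h0, by simpa using eB.strictMono.injective h1⟩

/-- The governing corner determines the edge. [folklore] -/
theorem edgeCorner_injective (eA : FlipEnum A) (eB : FlipEnum B) (c : ℤ) :
    Function.Injective (edgeCorner eA eB c) := by
  rintro ⟨x, t⟩ ⟨y, s⟩ h
  simp only [edgeCorner] at h
  fin_cases t <;> fin_cases s <;> simp only [Fin.isValue, Fin.zero_eta, Fin.mk_one, if_true, if_false,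
    show (1 : Fin 2) ≠ 0 by decide] at h ⊢
  · obtain ⟨h1, h2⟩ := cornerCell_injective eA eB h
    simp only [latBlk_fst, latBlk_snd] at h1 h2
    have : x = y := by ext k; fin_cases k <;> simp <;> omega
    subst this; rfl
  · obtain ⟨h1, h2⟩ := cornerCell_injective eA eB h
    simp only [latBlk_fst, latBlk_snd] at h1 h2; omega
  · obtain ⟨h1, h2⟩ := cornerCell_injective eA eB h
    simp only [latBlk_fst, latBlk_snd] at h1 h2; omega
  · obtain ⟨h1, h2⟩ := cornerCell_injective eA eB h
    simp only [latBlk_fst, latBlk_snd] at h1 h2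
    have : x = y := by ext k; fin_cases k <;> simp <;> omega
    subst this; rfl

/-- MEMBERSHIP IN THE COUPLED CONFIGURATION, main diagonal: `x — x+e₀` is open iff the coin of the corner cell of
`latBlk x` is off. [folklore] -/
theorem mk_add_e0_mem_couplingMap (eA : FlipEnum A) (eB : FlipEnum B) (c : ℤ) (C : Set (Site 2)) (x : Site 2) :
    s(x, x + ![1, 0]) ∈ couplingMap eA eB c C ↔ cornerCell eA eB (latBlk c x).1 (latBlk c x).2 ∉ C := by
  have he : s(x, x + ![1, 0]) = edgeOf (x, 0) := by simp only [edgeOf, single_zero_eq]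
  rw [couplingMap, he, edgeOf_injective.mem_set_image, Set.mem_symmDiff]
  simp [edgeCorner]

/-- MEMBERSHIP IN THE COUPLED CONFIGURATION, anti-diagonal: `x — x+e₁` is open iff the coin of the corner cell of
`latBlk x - (1, 0)` is on. [folklore] -/
theorem mk_add_e1_mem_couplingMap (eA : FlipEnum A) (eB : FlipEnum B) (c : ℤ) (C : Set (Site 2)) (x : Site 2) :
    s(x, x + ![0, 1]) ∈ couplingMap eA eB c C ↔ cornerCell eA eB ((latBlk c x).1 - 1) (latBlk c x).2 ∈ C := by
  have he : s(x, x + ![0, 1]) = edgeOf (x, 1) := by simp only [edgeOf, single_one_eq]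
  rw [couplingMap, he, edgeOf_injective.mem_set_image, Set.mem_symmDiff]
  simp [edgeCorner]

/-- Every coupled edge is a lattice edge `x — x + e_t`. [folklore] -/
theorem exists_of_mem_couplingMap (eA : FlipEnum A) (eB : FlipEnum B) (c : ℤ) (C : Set (Site 2)) {e : Sym2 (Site 2)}
    (h : e ∈ couplingMap eA eB c C) : ∃ x : Site 2, e = s(x, x + ![1, 0]) ∨ e = s(x, x + ![0, 1]) := by
  obtain ⟨⟨x, t⟩, -, rfl⟩ := h
  refine ⟨x, ?_⟩
  rcases (show t = 0 ∨ t = 1 by fin_cases t <;> simp) with rfl | rfl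
  · left; simp only [edgeOf, single_zero_eq]
  · right; simp only [edgeOf, single_one_eq]

/-- The coupled configuration lives on the lattice edges. [folklore] -/
theorem couplingMap_subset_edgeSet (eA : FlipEnum A) (eB : FlipEnum B) (c : ℤ) (C : Set (Site 2)) :
    couplingMap eA eB c C ⊆ (zdGraph 2).edgeSet := by
  rw [← range_edgeOf]; exact Set.image_subset_range _ _

/-! ## The law of the coupled configuration: bond percolation on `ℤ²` at `1/2` -/

-- adapted from `Theorems/CardyIKTransportIKLinearTransportStubPinnedExchange.lean` (`sitePercolation_half_map_symmDiff`)
/-- At density `1/2`, flipping the states of a fixed set of sites preserves `P_{1/2}`. [folklore] -/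
theorem sitePercolation_half_map_symmDiff {V : Type*} (D : Set V) :
    (sitePercolation V half).map (fun ω => ω ∆ D) = sitePercolation V half := by
  have hmeas : Measurable fun ω : Set V => ω ∆ D := measurable_set_iff.2 fun v => by
    simp only [Set.mem_symmDiff]
    exact ((measurable_set_mem v).and measurable_const).or
      (measurable_const.and (measurable_set_mem v).not)
  have hX : Measurable fun χ : V → Prop => fun v => Xor (χ v) (v ∈ D) :=
    measurable_pi_lambda _ fun v => ((measurable_pi_apply v).and measurable_const.not).or
      (measurable_const.and (measurable_pi_apply v).not)
  rw [Literature.Probability.Percolation.sitePercolation_eq_map, Measure.map_map hmeas measurable_setOf]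
  have hcomp : (fun ω : Set V => ω ∆ D) ∘ (fun χ : V → Prop => {v | χ v}) =
      (fun χ : V → Prop => {v | χ v}) ∘ (fun χ : V → Prop => fun v => Xor (χ v) (v ∈ D)) := by
    funext χ; ext v; simp [Set.mem_symmDiff, Xor]
  have hpi := Measure.infinitePi_map_pi (μ := fun _ : V => bernoulliProp half)
    (f := fun (v : V) (P : Prop) => Xor P (v ∈ D)) (fun v => measurable_of_finite _)
  have hfun : (fun v : V => (bernoulliProp half).map (fun P : Prop => Xor P (v ∈ D))) =
      fun _ => bernoulliProp half := by
    funext v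
    by_cases hv : v ∈ D
    · have h1 : (fun P : Prop => Xor P (v ∈ D)) = Not := by funext P; grind
      have hσ : unitInterval.symm half = half := Subtype.ext (by simp [half]; norm_num)
      rw [h1, bernoulliProp, ProbabilityTheory.map_bernoulliMeasure' _ _ (measurable_of_finite _),
        ProbabilityTheory.bernoulliMeasure_def, ProbabilityTheory.bernoulliMeasure_def, hσ,
        add_comm]
      simp
    · have h1 : (fun P : Prop => Xor P (v ∈ D)) = id := by funext P; grind
      rw [h1, Measure.map_id]
  rw [hcomp, ← Measure.map_map measurable_setOf hX, sitePi, hpi, hfun]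

/-- Pull-back of coins along the governing-corner map is measurable. [folklore] -/
theorem measurable_preimage_edgeCorner (eA : FlipEnum A) (eB : FlipEnum B) (c : ℤ) :
    Measurable fun C : Set (Site 2) => edgeCorner eA eB c ⁻¹' C :=
  measurable_set_iff.2 fun _ => measurable_set_mem _

/-- Flipping a fixed set of indices is measurable. [folklore] -/
theorem measurable_symmDiff_const {ι : Type*} (D : Set ι) : Measurable fun S : Set ι => S ∆ D :=
  measurable_set_iff.2 fun v => by
    simp only [Set.mem_symmDiff]
    exact ((measurable_set_mem v).and measurable_const).or (measurable_const.and (measurable_set_mem v).not)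

/-- The image under the injective `edgeOf` is measurable. [folklore] -/
theorem measurable_image_edgeOf : Measurable fun S : Set (Site 2 × Fin 2) => edgeOf '' S := by
  refine measurable_set_iff.2 fun e => ?_
  by_cases he : e ∈ Set.range edgeOf
  · obtain ⟨j, rfl⟩ := he
    have h : (fun S : Set (Site 2 × Fin 2) => edgeOf j ∈ edgeOf '' S) = fun S => j ∈ S :=
      funext fun S => propext edgeOf_injective.mem_set_image
    rw [h]; exact measurable_set_mem j
  · have h : (fun S : Set (Site 2 × Fin 2) => e ∈ edgeOf '' S) = fun _ => False :=
      funext fun S => propext ⟨fun ⟨j, _, hj⟩ => he ⟨j, hj⟩, False.elim⟩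
    rw [h]; exact measurable_const

/-- The coupling map is measurable. [folklore] -/
theorem measurable_couplingMap (eA : FlipEnum A) (eB : FlipEnum B) (c : ℤ) :
    Measurable (couplingMap eA eB c) :=
  measurable_image_edgeOf.comp ((measurable_symmDiff_const _).comp (measurable_preimage_edgeCorner eA eB c))

/-- THE LAW OF THE COUPLED CONFIGURATION: given the grid, the fair coins induce exactly Bernoulli bond percolation at
`1/2` on the standard lattice `ℤ²` (pull-back along the injective governing-corner map, a flip on the type-`0`
indices, push-forward along the injective `edgeOf` onto the edge set). [folklore] -/
theorem map_couplingMap (eA : FlipEnum A) (eB : FlipEnum B) (c : ℤ) :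
    (sitePercolation (Site 2) half).map (couplingMap eA eB c) = bondPercolation (zdGraph 2) half := by
  have hcomp : couplingMap eA eB c = (fun S : Set (Site 2 × Fin 2) => edgeOf '' S) ∘
      ((fun S : Set (Site 2 × Fin 2) => S ∆ {j | j.2 = 0}) ∘ fun C : Set (Site 2) => edgeCorner eA eB c ⁻¹' C) := rfl
  rw [hcomp, ← Measure.map_map measurable_image_edgeOf
      ((measurable_symmDiff_const _).comp (measurable_preimage_edgeCorner eA eB c)),
    ← Measure.map_map (measurable_symmDiff_const _) (measurable_preimage_edgeCorner eA eB c)]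
  rw [show sitePercolation (Site 2) half = setBer((Set.univ : Set (Site 2)), half) from rfl,
    Literature.Probability.Percolation.setBernoulli_univ_map_preimage (edgeCorner_injective eA eB c),
    show setBer((Set.univ : Set (Site 2 × Fin 2)), half) = sitePercolation (Site 2 × Fin 2) half from rfl,
    sitePercolation_half_map_symmDiff,
    show sitePercolation (Site 2 × Fin 2) half = setBer((Set.univ : Set (Site 2 × Fin 2)), half) from rfl,
    Literature.Probability.Percolation.setBernoulli_univ_map_image edgeOf_injective, range_edgeOf]
  rfl

/-! ## Walks: the coupled lattice configuration and the block bonds correspond along `latBlk` / `blkLat` -/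

/-- LATTICE EDGES ARE BLOCK BONDS: an open coupled edge `s(x, y)` gives the open block bond `s(latBlk x, latBlk y)`
(for the bit configuration `ω` carrying the grid of `eA`, `eB` and the coins). [folklore] -/
theorem latBlk_mem_blockBonds {ω : Bits} (eA : FlipEnum ω.1) (eB : FlipEnum ω.2.1) (c : ℤ) {x y : Site 2}
    (h : s(x, y) ∈ couplingMap eA eB c ω.2.2.2.2) :
    s(latBlk c x, latBlk c y) ∈ blockBonds ω eA eB := by
  obtain ⟨x₀, he | he⟩ := exists_of_mem_couplingMap eA eB c _ h
  · have hm : cornerCell eA eB (latBlk c x₀).1 (latBlk c x₀).2 ∉ ω.2.2.2.2 := by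
      rw [← mk_add_e0_mem_couplingMap]; rwa [← he]
    have hb : latBlk c (x₀ + ![1, 0]) = ((latBlk c x₀).1 + 1, (latBlk c x₀).2 + 1) := by
      ext <;> simp [latBlk] <;> ring
    have key : s(latBlk c x₀, latBlk c (x₀ + ![1, 0])) ∈ blockBonds ω eA eB :=
      ⟨(latBlk c x₀).1, (latBlk c x₀).2, Or.inl ⟨by rw [hb], hm⟩⟩
    rcases Sym2.eq_iff.1 he with ⟨rfl, rfl⟩ | ⟨rfl, rfl⟩
    · exact key
    · rw [Sym2.eq_swap]; exact key
  · have hm : cornerCell eA eB ((latBlk c x₀).1 - 1) (latBlk c x₀).2 ∈ ω.2.2.2.2 := by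
      rw [← mk_add_e1_mem_couplingMap]; rwa [← he]
    have hb : latBlk c (x₀ + ![0, 1]) = ((latBlk c x₀).1 - 1, (latBlk c x₀).2 + 1) := by
      ext <;> simp [latBlk] <;> ring
    have key : s(latBlk c x₀, latBlk c (x₀ + ![0, 1])) ∈ blockBonds ω eA eB := by
      refine ⟨(latBlk c x₀).1 - 1, (latBlk c x₀).2, Or.inr ⟨?_, hm⟩⟩
      rw [hb, Sym2.eq_swap]
      congr 1; ext <;> simp
    rcases Sym2.eq_iff.1 he with ⟨rfl, rfl⟩ | ⟨rfl, rfl⟩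
    · exact key
    · rw [Sym2.eq_swap]; exact key

/-- `latBlk` is injective. [folklore] -/
theorem latBlk_injective (c : ℤ) : Function.Injective (latBlk c) := fun x y h => by rw [← blkLat_latBlk c x, h, blkLat_latBlk]

/-- LATTICE WALKS PROJECT TO BLOCK WALKS: `{x ↔ y in S}` for the coupled configuration gives
`{latBlk x ↔ latBlk y in latBlk '' S}` for the block bonds. [folklore] -/
theorem blockConnIn_of_latticeConnIn {ω : Bits} (eA : FlipEnum ω.1) (eB : FlipEnum ω.2.1) (c : ℤ)
    {S : Set (Site 2)} {x y : Site 2} (h : couplingMap eA eB c ω.2.2.2.2 ∈ openConnIn S x y) :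
    blockBonds ω eA eB ∈ openConnIn (latBlk c '' S) (latBlk c x) (latBlk c y) := by
  rw [mem_openConnIn_iff_exists_openWalk] at h ⊢
  obtain ⟨w, hw⟩ := h
  let φ : openGraph (couplingMap eA eB c ω.2.2.2.2) →g openGraph (blockBonds ω eA eB) :=
    { toFun := latBlk c
      map_rel' := fun {a b} hab => by
        rw [openGraph_adj] at hab ⊢
        exact ⟨latBlk_mem_blockBonds eA eB c hab.1, fun h => hab.2 (latBlk_injective c h)⟩ }
  refine ⟨w.map φ, fun v hv => ?_⟩
  rw [SimpleGraph.Walk.support_map, List.mem_map] at hv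
  obtain ⟨u, hu, rfl⟩ := hv
  exact Set.mem_image_of_mem _ (hw u hu)

/-- BLOCK BONDS ARE LATTICE EDGES on the parity class of `c`: an open block bond from a block of the class gives an
open coupled edge between the corresponding lattice vertices, and stays in the class. [folklore] -/
theorem blkLat_adj_of_mem_blockBonds {ω : Bits} (eA : FlipEnum ω.1) (eB : FlipEnum ω.2.1) {c : ℤ} {a b : ℤ × ℤ}
    (ha : Even (a.1 + a.2 - c)) (h : s(a, b) ∈ blockBonds ω eA eB) :
    Even (b.1 + b.2 - c) ∧ s(blkLat c a, blkLat c b) ∈ couplingMap eA eB c ω.2.2.2.2 ∧ blkLat c a ≠ blkLat c b := by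
  have hb : Even (b.1 + b.2 - c) := by
    have h1 := even_of_mem_blockBonds h
    have : b.1 + b.2 - c = (a.1 + a.2 - c) - (a.1 + a.2 - (b.1 + b.2)) := by ring
    rw [this]; exact ha.sub h1
  refine ⟨hb, ?_, fun heq => ne_of_mem_blockBonds h ?_⟩
  · obtain ⟨i, j, ⟨he, hc⟩ | ⟨he, hc⟩⟩ := h
    · -- main diagonal `(i,j) — (i+1,j+1)`
      have hij : Even (i + j - c) := by
        rcases Sym2.eq_iff.1 he with ⟨rfl, rfl⟩ | ⟨rfl, rfl⟩
        · exact ha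
        · exact hb
      have h1 := blkLat_add_one_one hij
      have hl : latBlk c (blkLat c (i, j)) = (i, j) := latBlk_blkLat hij
      have key : s(blkLat c (i, j), blkLat c (i + 1, j + 1)) ∈ couplingMap eA eB c ω.2.2.2.2 := by
        rw [h1, mk_add_e0_mem_couplingMap, hl]; exact hc
      rcases Sym2.eq_iff.1 he with ⟨rfl, rfl⟩ | ⟨rfl, rfl⟩
      · exact key
      · rw [Sym2.eq_swap]; exact key
    · -- anti-diagonal `(i,j+1) — (i+1,j)`
      have hij : Even (i + 1 + j - c) := by
        rcases Sym2.eq_iff.1 he with ⟨rfl, rfl⟩ | ⟨rfl, rfl⟩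
        · obtain ⟨k, hk⟩ := ha; exact ⟨k, by simp at hk; omega⟩
        · obtain ⟨k, hk⟩ := hb; exact ⟨k, by simp at hk; omega⟩
      have h1 := blkLat_anti hij
      have hl : latBlk c (blkLat c (i + 1, j)) = (i + 1, j) := latBlk_blkLat hij
      have key : s(blkLat c (i + 1, j), blkLat c (i, j + 1)) ∈ couplingMap eA eB c ω.2.2.2.2 := by
        rw [h1, mk_add_e1_mem_couplingMap, hl]; simpa using hc
      rcases Sym2.eq_iff.1 he with ⟨rfl, rfl⟩ | ⟨rfl, rfl⟩
      · rw [Sym2.eq_swap]; exact key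
      · exact key
  · rw [← latBlk_blkLat ha, ← latBlk_blkLat hb, heq]

/-- BLOCK WALKS LIFT TO LATTICE WALKS: from a block of the parity class of `c`, `{a ↔ b in S}` for the block bonds
gives `{blkLat a ↔ blkLat b in blkLat '' (S ∩ class c)}` for the coupled configuration (the walk stays in the class).
[folklore] -/
theorem latticeConnIn_of_blockConnIn {ω : Bits} (eA : FlipEnum ω.1) (eB : FlipEnum ω.2.1) {c : ℤ}
    {S : Set (ℤ × ℤ)} {a b : ℤ × ℤ} (ha : Even (a.1 + a.2 - c)) (h : blockBonds ω eA eB ∈ openConnIn S a b) :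
    couplingMap eA eB c ω.2.2.2.2 ∈
      openConnIn (blkLat c '' {b ∈ S | Even (b.1 + b.2 - c)}) (blkLat c a) (blkLat c b) := by
  rw [mem_openConnIn_iff_exists_openWalk] at h ⊢
  obtain ⟨w, hw⟩ := h
  suffices key : ∀ (a b : ℤ × ℤ) (w : (openGraph (blockBonds ω eA eB)).Walk a b), Even (a.1 + a.2 - c) →
      (∀ v ∈ w.support, v ∈ S) → ∃ w' : (openGraph (couplingMap eA eB c ω.2.2.2.2)).Walk (blkLat c a) (blkLat c b),
        ∀ v ∈ w'.support, v ∈ blkLat c '' {b ∈ S | Even (b.1 + b.2 - c)} from key a b w ha hw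
  intro a b w
  induction w with
  | nil => exact fun ha hS => ⟨SimpleGraph.Walk.nil, fun v hv => by
      simp only [SimpleGraph.Walk.support_nil, List.mem_singleton] at hv
      subst hv; exact Set.mem_image_of_mem _ ⟨hS _ (by simp), ha⟩⟩
  | cons hadj p ih =>
    rename_i a a' _
    intro ha hS
    rw [openGraph_adj] at hadj
    obtain ⟨ha', hmem, hne⟩ := blkLat_adj_of_mem_blockBonds eA eB ha hadj.1
    obtain ⟨w', hw'⟩ := ih ha' fun v hv => hS v (by simp [hv])
    refine ⟨SimpleGraph.Walk.cons ((openGraph_adj _ _ _).2 ⟨hmem, hne⟩) w', fun v hv => ?_⟩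
    rw [SimpleGraph.Walk.support_cons, List.mem_cons] at hv
    rcases hv with rfl | hv
    · exact Set.mem_image_of_mem _ ⟨hS _ (by simp), ha⟩
    · exact hw' v hv

end Freeze

/-- ANCHOR (registered sub-goal). THE LAW OF THE RENEWAL-GRID COUPLING: for every grid (flip enumerations of the column
and row bits) and black class, the fair coins of the frozen gauge push forward along the coupling map to Bernoulli bond
percolation at `1/2` on the standard lattice `ℤ²`. [folklore] -/
theorem coinLaw_map_couplingMap : ∀ (A B : Set ℤ) (eA : Freeze.FlipEnum A) (eB : Freeze.FlipEnum B) (c : ℤ), (sitePercolation (Site 2) half).map (Freeze.couplingMap eA eB c) = bondPercolation (zdGraph 2) half :=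
  fun _ _ eA eB c => Freeze.map_couplingMap eA eB c

end Summit.CriticalPhenomena.CardyFormulaZ2.Theorems.CornerLineDescent.SymmetricSeed
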